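/-
Copyright: statement-level skeleton of a published paper (lit-balaban cell, Phase-2 proof seat p37 gen 105). No claims beyond
what the kernel checks below.
-/
import Literature.MathematicalPhysics.QuantumFieldTheory.Balaban1983to89.B3Sect1Graphs122

/-!
# B3 — T. Bałaban, *(Higgs)₂,₃ quantum fields in a finite volume. III. Renormalization*, CMP **88** (1983) 411–445
[Balaban1983Higgs3] — p. 415 [PDF 5] *"connected in the usual sense"* and p. 416 [PDF 6] *"amputated, one-particle-irreducible
graphs"*: CONNECTEDNESS and ONE-PARTICLE-IRREDUCIBILITY as predicates on the concrete graph model `B3Cor23Concrete.Graph`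
(p18), decided by the kernel on the seven displayed self-energy pictures of (1.22)

statement-level skeleton of published theorems with citation tags; proofs where landed; nothing here is a claim about
the Yang–Mills mass gap

PDF held: `paper:balaban1983-higgs-2-3-quantum-fields-finite-volume` (journal page = PDF page + 410); pp. 415–417 read in the
text layer (`p0005.txt`–`p0007.txt` of `lit read`; p. 417 l.16 *"one-particle-irreducible graphs with two external legs of scalar
fields"*) and on the ×2 renders `run/shared/lean/pub/pub-balaban/b2b-balaban-ref1/pages/1983-cmp88-higgs23-III/
1983-cmp88-higgs23-III-p005, p006-x2.png` (the seven pictures of (1.22) are drawings; their reading as graphs of the model is p18's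
`B3Sect1Graphs122`, module docstring there).

CITATION HEADER (lean-in-tree rule).  lit-balaban TYPED SKELETON (HOME `run/shared/lean/pub/lit-balaban/`), PHASE 2, seat p37
gen 105 (unit `lit-balaban-p37`; TAKING line HOME/STATUS.md 2026-08-23T08:13:46Z, owner r15 g15 «WELCOME, no objection»
08:14:29Z), row **B3.Eq1.19-1.22** of `HOME/lit-balaban-r15/ROWS-B3.md` (fold owner r15, referee ref-4) — the owner's HEAD
QUESTION 25 (HOME/INBOX 2026-08-23T07:43:33Z) isolated the p. 416 sentence *"Σ^ε, Σ₁^ε, Σ₂^ε are given by amputated,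
one-particle-irreducible graphs of the expansion of G^ε"* with the standing disclosure «1PI not modelled» (no 1PI predicate in the
tree: p32 g40 `B3Eq121DysonSeries` HONEST SCOPE (ii); p18 `B3Sect1Graphs122` *"NOT here: … 1PI-ness"*; p18 `B3Cor23Concrete`
*"Connectedness … is NOT imposed"*); lead g12 HEAD WORD Q25 (HOME/STATUS 2026-08-23T08:24:18Z): row AGREED under reading (P),
the bricks of the `B3TwoPointPerturbativeExpansion` programme WELCOME as located members (zero head weight).  This file is
BRICK 3 of that programme, disjoint from p39 g22's BRICK 1 `B3Eq122FirstOrderWick` (first-order Wick) and p32 g41's BRICK 2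
`B3Eq121OnePIChains` (chains of insertions ↦ (1.21) in the formal power series ring; p32 names the graph side *"not derived on
`B3Cor23Concrete.Graph`"* — this file supplies that graph-side vocabulary); it also serves the «1PI not modelled» clause of row
B3.Txt@430 (p. 430 *"We consider one-particle-irreducible graphs only"*, lead Q15) with a model predicate.  REUSED BY NAME, nothing
re-declared: p18's model `B3Cor23Concrete.Graph`/`Leg` (the p. 415 graph notion, `Graph.exists_line`, `Graph.other_symm`), p18's
drawn pictures `B3Sect3LowestOrderGraphs.g36a/g36b/g36c`, `B3Sect3Graphs318.g318a/g318b/g318g`, `B3Sect1Graphs122.g122g` (= the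
seven pictures ①–⑦ of (1.22); p26's `B3Eq123Counterterms.pics_graphs` lists the same seven graphs under `pics122`).  The sibling
`B3OnePIPictureCensus` (same seat) decides the other drawn self-energy / three-leg pictures of the tree and gives non-examples.

THE PRINTED TEXT (verbatim).  p. 415: *"Now a graph for us is a collection of internal lines, external legs, and vertices
connected in the usual sense. There is at least one internal line, and every internal line has a vertex at each endpoint. The
construction of graphs is otherwise arbitrary."*  p. 416: *"The function G^ε has a perturbative expansion of the following
structure G^ε = Σ_{n=0}^∞ C₀^ε[(−δm² + Σ^ε + ∂^{ε*}Σ₁^ε + Σ₁^{ε*}∂^ε + ∂^{ε*}Σ₂^ε∂^ε)C₀^ε]ⁿ, (1.21) where C₀^ε = (−Δ₀^ε + m²)^{−1} and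
Σ^ε, Σ₁^ε, Σ₂^ε are given by amputated, one-particle-irreducible graphs of the expansion of G^ε. … Let us write a few terms of the
expansion of Σ^ε: (1.22) [seven analytic terms = seven pictures] + ⋯"*.  p. 417: *"A term e^αλ^βΣ^ε_{(α,β)} can be written also as
a sum of terms Σ^ε_G, the summation over a family of one-particle-irreducible graphs with two external legs of scalar fields."*
p. 423 [PDF 13]: *"Let us define a degree of a connected graph G …"*.

WHAT IS TYPED / PROVED (definitions with bodies + kernel theorems; no `Prop` fact, no `sorry`; standard axioms; every decision is
the kernel's `decide` on closed data, no `native_decide`).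
§1 ON THE MODEL.  For the line data `other : Leg kind → Option (Leg kind)` of a graph: `AdjOf other i j` (the vertices `i`, `j`
are the two endpoints of an internal line), `AdjOffOf other c i j` (the same after CUTTING the internal line through the leg `c`);
for `G : Graph n̄`: `Adj G`, `AdjOff G c`, **`IsConnected G`** (p. 415 *"connected in the usual sense"*: every two vertices joined by
a path of internal lines — `Relation.ReflTransGen`; p18's carrier deliberately does not impose it), `IsConnectedOff G c`,
**`IsOnePI G`** (:= connected, and connected after cutting any one internal line — the textbook meaning of *"one-particle-
irreducible"*; print does not define the term), the two-leg channel variant **`IsProper G`** (connected, and no internal line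
separates two external legs) with `IsOnePI.isProper` (the converse fails exactly on graphs with a part attached through one line
away from the channel — `B3OnePIPictureCensus.not_isOnePI_g321Y`/`isProper_g321Y`); symmetry of both adjacencies from p18's
`other_symm`, `reflTransGen_adj_symm`, `isConnected_of_root`, `IsConnectedOff.isConnected`, **`isOnePI_of_nV_eq_one`** (a
one-vertex graph — a tadpole picture — is 1PI: cutting a loop separates nothing), the closed-set obstruction
`not_reflTransGen_of_closed`; Boolean deciders `reachB`/`connB`/`onePIBOf`/`properBOf`/`sepWitnessB`/`splitB`/`detachedB`/
`legSplitB` with SOUNDNESS in structure-literal form (`isConnected_mk`, `isOnePI_mk`, `isProper_mk`, `not_isConnected_mk`,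
`not_isOnePI_mk`, `not_isProper_mk`): they read the line data off the structure literal, so that the kernel decides CLOSED Booleans
although the pictures carry the parameter n̄.
§2 **THE SEVEN PICTURES OF (1.22) ARE CONNECTED, ONE-PARTICLE-IRREDUCIBLE GRAPHS OF THE MODEL**: `isOnePI_pic122_1` … `_7` for
p18's ① `g36c`, ② `g36b`, ③ `g318b`, ④ `g36a`, ⑤ `g318a`, ⑥ `g318g`, ⑦ `g122g`, collected in `pictures122_isOnePI`,
`pictures122_isConnected`, `pictures122_isProper` — print's sentence checked on its own displayed terms.
HONEST SCOPE.  Predicates and decisions on the displayed pictures only: no enumeration of "all 1PI graphs of the expansion of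
G^ε", the «+ ⋯» of (1.22) untouched, "amputated" (a convention on the EXPRESSION — external propagators stripped) is not a graph
datum; the bridge/chain decomposition «connected two-leg graph = chain of proper pieces joined by single lines» is NOT derived
here (p32's BRICK 2 indexes chains abstractly); nothing analytic (Wick expansion of (1.19): p39's BRICK 1).
-/

namespace Literature.MathematicalPhysics.QuantumFieldTheory.Balaban1983to89.B3OnePIGraphs

open Relation B3Prop1 B3Cor23Concrete B3Sect3LowestOrderGraphs B3Sect3Graphs318 B3Sect1Graphs122

variable {nbar : ℕ}

/-! ## §1 Connectedness and one-particle-irreducibility on the model -/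

/-! ### §1.1 Adjacency through internal lines, for the line data of a graph -/

section LineData

variable {nV : ℕ} {kind : Fin nV → VertexKind} (other : Leg kind → Option (Leg kind))

/-- `AdjOf other i j`: for the line data `other` (p18's "the other endpoint of the line through this leg"), the vertices `i` and `j`
are the two endpoints of an internal line (p. 415: *"every internal line has a vertex at each endpoint"*; a loop gives
`AdjOf other i i`). [cite: Balaban1983Higgs3, p.415] -/
def AdjOf (i j : Fin nV) : Prop :=
  ∃ x : Leg kind, x.1 = i ∧ (other x).map Sigma.fst = some j

/-- `AdjOffOf other c i j`: `i` and `j` are the endpoints of an internal line OTHER than the line through the leg `c` — adjacency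
after cutting that one line (the legs `c` and `other c` become external). [cite: Balaban1983Higgs3, (1.21) p.416] -/
def AdjOffOf (c : Leg kind) (i j : Fin nV) : Prop :=
  ∃ x : Leg kind, x.1 = i ∧ x ≠ c ∧ other x ≠ some c ∧ (other x).map Sigma.fst = some j

/-- `AdjOf` is decidable (finitely many legs). [cite: Balaban1983Higgs3, p.415] -/
instance instDecidableAdjOf (i j : Fin nV) : Decidable (AdjOf other i j) := by
  unfold AdjOf; infer_instance

/-- `AdjOffOf` is decidable (finitely many legs). [cite: Balaban1983Higgs3, (1.21) p.416] -/
instance instDecidableAdjOffOf (c : Leg kind) (i j : Fin nV) : Decidable (AdjOffOf other c i j) := by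
  unfold AdjOffOf; infer_instance

variable {other}

/-- kernel: `AdjOf` unfolded — an internal line with endpoints at `i` and `j`. [cite: Balaban1983Higgs3, p.415] -/
theorem adjOf_iff {i j : Fin nV} :
    AdjOf other i j ↔ ∃ x y : Leg kind, other x = some y ∧ x.1 = i ∧ y.1 = j := by
  constructor
  · rintro ⟨x, hx, hj⟩
    cases h : other x with
    | none => simp [h] at hj
    | some y => exact ⟨x, y, h, hx, by simpa [h] using hj⟩
  · rintro ⟨x, y, h, hx, hy⟩
    exact ⟨x, hx, by simp [h, hy]⟩

/-- kernel: `AdjOffOf` unfolded — an internal line other than the one through `c`, with endpoints at `i` and `j`.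
[cite: Balaban1983Higgs3, (1.21) p.416] -/
theorem adjOffOf_iff {c : Leg kind} {i j : Fin nV} :
    AdjOffOf other c i j ↔ ∃ x y : Leg kind, other x = some y ∧ x ≠ c ∧ y ≠ c ∧ x.1 = i ∧ y.1 = j := by
  constructor
  · rintro ⟨x, hx, hxc, hyc, hj⟩
    cases h : other x with
    | none => simp [h] at hj
    | some y =>
        refine ⟨x, y, h, hxc, ?_, hx, by simpa [h] using hj⟩
        rintro rfl
        exact hyc h
  · rintro ⟨x, y, h, hxc, hyc, hx, hy⟩
    refine ⟨x, hx, hxc, ?_, by simp [h, hy]⟩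
    rw [h]
    exact fun e => hyc (Option.some.inj e)

/-- kernel: cutting a line only removes adjacencies. [cite: Balaban1983Higgs3, (1.21) p.416] -/
theorem AdjOffOf.adjOf {c : Leg kind} {i j : Fin nV} (h : AdjOffOf other c i j) : AdjOf other i j := by
  obtain ⟨x, hx, -, -, hj⟩ := h
  exact ⟨x, hx, hj⟩

end LineData

/-! ### §1.2 Boolean deciders for reachability on `Fin m`, with soundness -/

section Deciders

variable {m : ℕ} (P : Fin m → Fin m → Prop) [DecidableRel P]

/-- `reachB P n i j`: `j` is reachable from `i` by at most `n` steps of the decidable relation `P` on `Fin m` (Boolean).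
[cite: Balaban1983Higgs3, p.415] -/
def reachB : ℕ → Fin m → Fin m → Bool
  | 0, i, j => decide (i = j)
  | n + 1, i, j => reachB n i j || decide (∃ k : Fin m, reachB n i k = true ∧ P k j)

/-- `connB P n`: every vertex reaches every vertex within `n` steps (Boolean). [cite: Balaban1983Higgs3, p.415] -/
def connB (n : ℕ) : Bool :=
  decide (∀ i j : Fin m, reachB P n i j = true)

/-- `sepWitnessB P S i j`: the Boolean set `S` is closed under `P`, contains `i` and misses `j` — a certificate that `j` is NOT
reachable from `i`. [cite: Balaban1983Higgs3, p.415] -/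
def sepWitnessB (S : Fin m → Bool) (i j : Fin m) : Bool :=
  decide (∀ a b : Fin m, S a = true → P a b → S b = true) && (S i && !S j)

variable {P}

/-- SOUNDNESS of `reachB`: a Boolean witness gives a path. [cite: Balaban1983Higgs3, p.415] -/
theorem reflTransGen_of_reachB : ∀ (n : ℕ) (i j : Fin m), reachB P n i j = true → ReflTransGen P i j
  | 0, i, j, h => by
      have hij : i = j := by simpa [reachB] using h
      subst hij
      exact ReflTransGen.refl
  | n + 1, i, j, h => by
      simp only [reachB, Bool.or_eq_true, decide_eq_true_eq] at h
      rcases h with h | ⟨k, hk, hkj⟩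
      · exact reflTransGen_of_reachB n i j h
      · exact ReflTransGen.tail (reflTransGen_of_reachB n i k hk) hkj

/-- SOUNDNESS of `connB`. [cite: Balaban1983Higgs3, p.415] -/
theorem forall_reflTransGen_of_connB {n : ℕ} (h : connB P n = true) : ∀ i j : Fin m, ReflTransGen P i j := by
  simp only [connB, decide_eq_true_eq] at h
  exact fun i j => reflTransGen_of_reachB n i j (h i j)

/-- kernel (the obstruction used for the non-examples): a set closed under a relation and containing `i` but not `j` shows `j`
is not reachable from `i`. [cite: Balaban1983Higgs3, p.415] -/
theorem not_reflTransGen_of_closed {α : Type*} {r : α → α → Prop} (S : α → Prop)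
    (hS : ∀ a b, S a → r a b → S b) {i j : α} (hi : S i) (hj : ¬ S j) : ¬ ReflTransGen r i j := by
  intro h
  apply hj
  clear hj
  induction h with
  | refl => exact hi
  | tail _ hab ih => exact hS _ _ ih hab

/-- SOUNDNESS of `sepWitnessB`: a Boolean separation certificate refutes reachability. [cite: Balaban1983Higgs3, p.415] -/
theorem not_reflTransGen_of_sepWitnessB {S : Fin m → Bool} {i j : Fin m} (h : sepWitnessB P S i j = true) :
    ¬ ReflTransGen P i j := by
  simp only [sepWitnessB, Bool.and_eq_true, decide_eq_true_eq, Bool.not_eq_true'] at h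
  obtain ⟨hS, hi, hj⟩ := h
  exact not_reflTransGen_of_closed (fun a => S a = true) hS hi (by simp [hj])

end Deciders

/-! ### §1.3 The predicates on a graph of the model -/

section Model

variable (G : Graph nbar)

/-- `Adj G i j`: the vertices `i` and `j` of `G` are the two endpoints of an internal line of `G` (reducible synonym of `AdjOf G.other`).
[cite: Balaban1983Higgs3, p.415] -/
abbrev Adj : Fin G.nV → Fin G.nV → Prop :=
  AdjOf G.other

/-- `AdjOff G c i j`: adjacency of `G` after cutting the internal line through the leg `c` (reducible synonym of `AdjOffOf G.other c`).
[cite: Balaban1983Higgs3, (1.21) p.416] -/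
abbrev AdjOff (c : Leg G.kind) : Fin G.nV → Fin G.nV → Prop :=
  AdjOffOf G.other c

/-- **p. 415 [PDF 5], verbatim: *"Now a graph for us is a collection of internal lines, external legs, and vertices connected in
the usual sense."*** — `IsConnected G`: every two vertices of `G` are joined by a path of internal lines (the reflexive–transitive
closure of `Adj G`).  p18's carrier `B3Cor23Concrete.Graph` deliberately does not impose it (*"Connectedness … is NOT imposed"*);
here it is a predicate on that carrier (cf. p. 423 *"a degree of a connected graph"*). [cite: Balaban1983Higgs3, p.415] -/
def IsConnected (G : Graph nbar) : Prop :=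
  ∀ i j : Fin G.nV, ReflTransGen (Adj G) i j

/-- `IsConnectedOff G c`: `G` stays connected after cutting the internal line through the leg `c`.
[cite: Balaban1983Higgs3, (1.21) p.416] -/
def IsConnectedOff (G : Graph nbar) (c : Leg G.kind) : Prop :=
  ∀ i j : Fin G.nV, ReflTransGen (AdjOff G c) i j

/-- **p. 416 [PDF 6], verbatim: *"Σ^ε, Σ₁^ε, Σ₂^ε are given by amputated, one-particle-irreducible graphs of the expansion of
G^ε"*** — `IsOnePI G`: `G` is connected and stays connected after cutting ANY ONE internal line (the textbook meaning of
"one-particle-irreducible"; the print uses the term without a definition; "amputated" is a convention on the expression — the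
external propagators stripped — and is not a datum of the graph). [cite: Balaban1983Higgs3, (1.21) p.416] -/
def IsOnePI (G : Graph nbar) : Prop :=
  IsConnected G ∧ ∀ c : Leg G.kind, (G.other c).isSome → IsConnectedOff G c

/-- The two-leg CHANNEL variant of irreducibility (the one the chain structure of (1.21) uses): `IsProper G` — `G` is connected
and no single internal line separates two external legs of `G` (after cutting any one line, the vertices carrying any two
external legs are still joined).  `IsOnePI G → IsProper G` (`IsOnePI.isProper`); the converse fails exactly on graphs with a
part attached through one line away from the channel (`B3OnePIPictureCensus.isProper_g321Y`). [cite: Balaban1983Higgs3, (1.21) p.416] -/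
def IsProper (G : Graph nbar) : Prop :=
  IsConnected G ∧ ∀ c : Leg G.kind, (G.other c).isSome →
    ∀ x₁ x₂ : Leg G.kind, G.other x₁ = none → G.other x₂ = none → ReflTransGen (AdjOff G c) x₁.1 x₂.1

variable {G}

/-- kernel: `Adj G` unfolded — an internal line of `G` with endpoints at `i` and `j`. [cite: Balaban1983Higgs3, p.415] -/
theorem adj_iff {i j : Fin G.nV} : Adj G i j ↔ ∃ x y : Leg G.kind, G.other x = some y ∧ x.1 = i ∧ y.1 = j :=
  adjOf_iff

/-- kernel: adjacency is symmetric (p18's `other_symm`: "the other endpoint" is symmetric). [cite: Balaban1983Higgs3, p.415] -/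
theorem adj_symm {i j : Fin G.nV} (h : Adj G i j) : Adj G j i := by
  obtain ⟨x, y, hxy, hx, hy⟩ := adjOf_iff.1 h
  exact adjOf_iff.2 ⟨y, x, G.other_symm _ _ hxy, hy, hx⟩

/-- kernel: adjacency after a cut is symmetric. [cite: Balaban1983Higgs3, (1.21) p.416] -/
theorem adjOff_symm {c : Leg G.kind} {i j : Fin G.nV} (h : AdjOff G c i j) : AdjOff G c j i := by
  obtain ⟨x, y, hxy, hxc, hyc, hx, hy⟩ := adjOffOf_iff.1 h
  exact adjOffOf_iff.2 ⟨y, x, G.other_symm _ _ hxy, hyc, hxc, hy, hx⟩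

/-- kernel: cutting a line only removes adjacencies. [cite: Balaban1983Higgs3, (1.21) p.416] -/
theorem AdjOff.adj {c : Leg G.kind} {i j : Fin G.nV} (h : AdjOff G c i j) : Adj G i j :=
  AdjOffOf.adjOf h

/-- kernel: paths of internal lines can be reversed. [cite: Balaban1983Higgs3, p.415] -/
theorem reflTransGen_adj_symm {i j : Fin G.nV} (h : ReflTransGen (Adj G) i j) : ReflTransGen (Adj G) j i := by
  induction h with
  | refl => exact ReflTransGen.refl
  | tail _ hab ih => exact ReflTransGen.head (adj_symm hab) ih

/-- kernel: paths avoiding a cut line can be reversed. [cite: Balaban1983Higgs3, (1.21) p.416] -/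
theorem reflTransGen_adjOff_symm {c : Leg G.kind} {i j : Fin G.nV} (h : ReflTransGen (AdjOff G c) i j) :
    ReflTransGen (AdjOff G c) j i := by
  induction h with
  | refl => exact ReflTransGen.refl
  | tail _ hab ih => exact ReflTransGen.head (adjOff_symm hab) ih

/-- kernel: connectedness from one root vertex. [cite: Balaban1983Higgs3, p.415] -/
theorem isConnected_of_root (r : Fin G.nV) (h : ∀ j, ReflTransGen (Adj G) r j) : IsConnected G :=
  fun i j => (reflTransGen_adj_symm (h i)).trans (h j)

/-- kernel: a graph that stays connected after a cut is connected. [cite: Balaban1983Higgs3, (1.21) p.416] -/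
theorem IsConnectedOff.isConnected {c : Leg G.kind} (h : IsConnectedOff G c) : IsConnected G := by
  intro i j
  have hij := h i j
  induction hij with
  | refl => exact ReflTransGen.refl
  | tail _ hab ih => exact ih.tail hab.adj

/-- kernel: a 1PI graph is connected. [cite: Balaban1983Higgs3, (1.21) p.416] -/
theorem IsOnePI.isConnected (h : IsOnePI G) : IsConnected G := h.1

/-- kernel: a 1PI graph is proper (no line separates two external legs). [cite: Balaban1983Higgs3, (1.21) p.416] -/
theorem IsOnePI.isProper (h : IsOnePI G) : IsProper G :=
  ⟨h.1, fun c hc x₁ x₂ _ _ => h.2 c hc x₁.1 x₂.1⟩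

/-- kernel: a proper graph is connected. [cite: Balaban1983Higgs3, (1.21) p.416] -/
theorem IsProper.isConnected (h : IsProper G) : IsConnected G := h.1

/-- kernel: a graph of the model with ONE vertex (a tadpole picture: all its lines are loops) is connected and 1PI — cutting a
loop cannot separate a single vertex. [cite: Balaban1983Higgs3, (1.21) p.416] -/
theorem isOnePI_of_nV_eq_one (h : G.nV = 1) : IsOnePI G := by
  have hs : ∀ i j : Fin G.nV, i = j := fun i j => by
    apply Fin.ext; have := i.isLt; have := j.isLt; omega
  exact ⟨fun i j => by rw [hs i j], fun c _ i j => by rw [hs i j]⟩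

/-- SOUNDNESS, structure-literal form: a Boolean connectivity certificate on the line data gives `IsConnected`.
[cite: Balaban1983Higgs3, p.415] -/
theorem isConnected_mk {nV : ℕ} {kind : Fin nV → VertexKind} {adm} {other : Leg kind → Option (Leg kind)} {h₁ h₂ h₃ h₄}
    {n : ℕ} (h : connB (AdjOf other) n = true) :
    IsConnected (⟨nV, kind, adm, other, h₁, h₂, h₃, h₄⟩ : Graph nbar) :=
  forall_reflTransGen_of_connB h

/-- `onePIBOf other n`: the Boolean 1PI check on line data — connected within `n` steps, and so after cutting each internal line.
[cite: Balaban1983Higgs3, (1.21) p.416] -/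
def onePIBOf {nV : ℕ} {kind : Fin nV → VertexKind} (other : Leg kind → Option (Leg kind)) (n : ℕ) : Bool :=
  connB (AdjOf other) n && decide (∀ c : Leg kind, (other c).isSome = true → connB (AdjOffOf other c) n = true)

/-- SOUNDNESS of `onePIBOf`. [cite: Balaban1983Higgs3, (1.21) p.416] -/
theorem isOnePI_of_onePIBOf {n : ℕ} (h : onePIBOf G.other n = true) : IsOnePI G := by
  simp only [onePIBOf, Bool.and_eq_true, decide_eq_true_eq] at h
  exact ⟨forall_reflTransGen_of_connB h.1, fun c hc => forall_reflTransGen_of_connB (h.2 c hc)⟩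

/-- SOUNDNESS, structure-literal form: `onePIBOf other n = true` on the line data gives `IsOnePI` (this is how the kernel decides
the pictures below: the line data of p18's drawn graphs are closed terms). [cite: Balaban1983Higgs3, (1.21) p.416] -/
theorem isOnePI_mk {nV : ℕ} {kind : Fin nV → VertexKind} {adm} {other : Leg kind → Option (Leg kind)} {h₁ h₂ h₃ h₄}
    {n : ℕ} (h : onePIBOf other n = true) : IsOnePI (⟨nV, kind, adm, other, h₁, h₂, h₃, h₄⟩ : Graph nbar) :=
  isOnePI_of_onePIBOf h

/-- `properBOf other n`: the Boolean check of `IsProper` on line data (connected within `n` steps; after each cut, the vertices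
of any two external legs joined within `n` steps). [cite: Balaban1983Higgs3, (1.21) p.416] -/
def properBOf {nV : ℕ} {kind : Fin nV → VertexKind} (other : Leg kind → Option (Leg kind)) (n : ℕ) : Bool :=
  connB (AdjOf other) n && decide (∀ c : Leg kind, (other c).isSome = true →
    ∀ x₁ x₂ : Leg kind, other x₁ = none → other x₂ = none → reachB (AdjOffOf other c) n x₁.1 x₂.1 = true)

/-- SOUNDNESS of `properBOf`. [cite: Balaban1983Higgs3, (1.21) p.416] -/
theorem isProper_of_properBOf {n : ℕ} (h : properBOf G.other n = true) : IsProper G := by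
  simp only [properBOf, Bool.and_eq_true, decide_eq_true_eq] at h
  exact ⟨forall_reflTransGen_of_connB h.1,
    fun c hc x₁ x₂ e₁ e₂ => reflTransGen_of_reachB n _ _ (h.2 c hc x₁ x₂ e₁ e₂)⟩

/-- SOUNDNESS, structure-literal form of `isProper_of_properBOf`. [cite: Balaban1983Higgs3, (1.21) p.416] -/
theorem isProper_mk {nV : ℕ} {kind : Fin nV → VertexKind} {adm} {other : Leg kind → Option (Leg kind)} {h₁ h₂ h₃ h₄}
    {n : ℕ} (h : properBOf other n = true) : IsProper (⟨nV, kind, adm, other, h₁, h₂, h₃, h₄⟩ : Graph nbar) :=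
  isProper_of_properBOf h

/-- `splitB other`: a Boolean certificate of DISconnectedness — some vertex `k` all of whose lines are loops, and another vertex `j`
(the vertex set {k} is closed under adjacency and misses `j`). [cite: Balaban1983Higgs3, p.415] -/
def splitB {nV : ℕ} {kind : Fin nV → VertexKind} (other : Leg kind → Option (Leg kind)) : Bool :=
  decide (∃ k j : Fin nV, sepWitnessB (AdjOf other) (fun a => decide (a = k)) k j = true)

/-- SOUNDNESS of `splitB`, structure-literal form: the graph is NOT connected. [cite: Balaban1983Higgs3, p.415] -/
theorem not_isConnected_mk {nV : ℕ} {kind : Fin nV → VertexKind} {adm} {other : Leg kind → Option (Leg kind)} {h₁ h₂ h₃ h₄}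
    (h : splitB other = true) : ¬ IsConnected (⟨nV, kind, adm, other, h₁, h₂, h₃, h₄⟩ : Graph nbar) := by
  simp only [splitB, decide_eq_true_eq] at h
  obtain ⟨k, j, hk⟩ := h
  exact fun hc => not_reflTransGen_of_sepWitnessB hk (hc k j)

/-- `detachedB other`: a Boolean certificate of one-particle REDUCIBILITY — an internal line (through the leg `c`) after whose cut
some vertex `k` keeps only loops while another vertex `j` exists. [cite: Balaban1983Higgs3, (1.21) p.416] -/
def detachedB {nV : ℕ} {kind : Fin nV → VertexKind} (other : Leg kind → Option (Leg kind)) : Bool :=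
  decide (∃ c : Leg kind, (other c).isSome = true ∧
    ∃ k j : Fin nV, sepWitnessB (AdjOffOf other c) (fun a => decide (a = k)) k j = true)

/-- SOUNDNESS of `detachedB`, structure-literal form: the graph is NOT 1PI. [cite: Balaban1983Higgs3, (1.21) p.416] -/
theorem not_isOnePI_mk {nV : ℕ} {kind : Fin nV → VertexKind} {adm} {other : Leg kind → Option (Leg kind)} {h₁ h₂ h₃ h₄}
    (h : detachedB other = true) : ¬ IsOnePI (⟨nV, kind, adm, other, h₁, h₂, h₃, h₄⟩ : Graph nbar) := by
  simp only [detachedB, decide_eq_true_eq] at h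
  obtain ⟨c, hc, k, j, hk⟩ := h
  exact fun h1 => not_reflTransGen_of_sepWitnessB hk (h1.2 c hc k j)

/-- `legSplitB other`: a Boolean certificate that the graph is NOT proper — an internal line (through `c`) after whose cut the
vertex of an external leg `x₁` keeps only loops while another external leg `x₂` sits at a different vertex.
[cite: Balaban1983Higgs3, (1.21) p.416] -/
def legSplitB {nV : ℕ} {kind : Fin nV → VertexKind} (other : Leg kind → Option (Leg kind)) : Bool :=
  decide (∃ c : Leg kind, (other c).isSome = true ∧ ∃ x₁ x₂ : Leg kind, other x₁ = none ∧ other x₂ = none ∧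
    sepWitnessB (AdjOffOf other c) (fun a => decide (a = x₁.1)) x₁.1 x₂.1 = true)

/-- SOUNDNESS of `legSplitB`, structure-literal form: the graph is NOT proper (hence not 1PI either).
[cite: Balaban1983Higgs3, (1.21) p.416] -/
theorem not_isProper_mk {nV : ℕ} {kind : Fin nV → VertexKind} {adm} {other : Leg kind → Option (Leg kind)} {h₁ h₂ h₃ h₄}
    (h : legSplitB other = true) : ¬ IsProper (⟨nV, kind, adm, other, h₁, h₂, h₃, h₄⟩ : Graph nbar) := by
  simp only [legSplitB, decide_eq_true_eq] at h
  obtain ⟨c, hc, x₁, x₂, e₁, e₂, hk⟩ := h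
  exact fun hp => not_reflTransGen_of_sepWitnessB hk (hp.2 c hc x₁ x₂ e₁ e₂)

/-- kernel: not proper ⇒ not 1PI. [cite: Balaban1983Higgs3, (1.21) p.416] -/
theorem not_isOnePI_of_not_isProper (h : ¬ IsProper G) : ¬ IsOnePI G := fun h1 => h h1.isProper

end Model

/-! ## §2 The seven pictures of (1.22) are connected, one-particle-irreducible graphs -/

section Pictures122

/-- **(1.22)① p. 416** — the φ-tadpole at the vertex (1.6) (p18's `g36c`) is 1PI. [cite: Balaban1983Higgs3, (1.22) p.416] -/
theorem isOnePI_pic122_1 : IsOnePI (g36c nbar) :=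
  isOnePI_of_nV_eq_one rfl

/-- **(1.22)② p. 416** — the A-tadpole at the vertex (1.10)_{2,0} (p18's `g36b`) is 1PI. [cite: Balaban1983Higgs3, (1.22) p.416] -/
theorem isOnePI_pic122_2 (hn2 : 2 ≤ nbar) : IsOnePI (g36b nbar hn2) :=
  isOnePI_of_nV_eq_one rfl

/-- **(1.22)③ p. 416** — the two A-tadpoles at the vertex (1.10)_{4,0} (p18's `g318b`) form a 1PI graph.
[cite: Balaban1983Higgs3, (1.22) p.416] -/
theorem isOnePI_pic122_3 (hn4 : 4 ≤ nbar) : IsOnePI (g318b nbar hn4) :=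
  isOnePI_of_nV_eq_one rfl

/-- **(1.22)④ p. 416** — two vertices (1.8)_{1,0} joined by the φ-line through both differentiated legs and by the A-line (p18's
`g36a` = (3.6)₁): connected and 1PI (cutting either line leaves the other). [cite: Balaban1983Higgs3, (1.22) p.416] -/
theorem isOnePI_pic122_4 (hn : 1 ≤ nbar) : IsOnePI (g36a nbar hn) :=
  isOnePI_mk (n := 1) (by decide)

/-- **(1.22)⑤ p. 416** — two vertices (1.10)_{2,0} joined by the φ-line and both A-lines (p18's `g318a`): 1PI.
[cite: Balaban1983Higgs3, (1.22) p.416] -/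
theorem isOnePI_pic122_5 (hn2 : 2 ≤ nbar) : IsOnePI (g318a nbar hn2) :=
  isOnePI_mk (n := 1) (by decide)

/-- **(1.22)⑥ p. 416** — the sunset: two vertices (1.6) joined by three φ-lines (p18's `g318g`): 1PI.
[cite: Balaban1983Higgs3, (1.22) p.416] -/
theorem isOnePI_pic122_6 : IsOnePI (g318g nbar) :=
  isOnePI_mk (n := 1) (by decide)

/-- **(1.22)⑦ p. 416** — the graph ④ with a mass-renormalization vertex (1.7) «δm²» on its φ-line (p18's `g122g`, three
vertices): connected and 1PI (each of its three lines lies on the cycle x—x″—x′—x). [cite: Balaban1983Higgs3, (1.22) p.416] -/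
theorem isOnePI_pic122_7 (hn : 1 ≤ nbar) : IsOnePI (g122g nbar hn) :=
  isOnePI_mk (n := 2) (by decide)

/-- **p. 416, the sentence on the displayed terms**: the seven pictures ①–⑦ of (1.22) (p18's `g36c`, `g36b`, `g318b`, `g36a`,
`g318a`, `g318g`, `g122g`; the same list as `B3Eq123Counterterms.pics_graphs`) are one-particle-irreducible graphs of the model.
[cite: Balaban1983Higgs3, (1.22) p.416] -/
theorem pictures122_isOnePI (hn : 1 ≤ nbar) (hn2 : 2 ≤ nbar) (hn4 : 4 ≤ nbar) :
    IsOnePI (g36c nbar) ∧ IsOnePI (g36b nbar hn2) ∧ IsOnePI (g318b nbar hn4) ∧ IsOnePI (g36a nbar hn) ∧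
      IsOnePI (g318a nbar hn2) ∧ IsOnePI (g318g nbar) ∧ IsOnePI (g122g nbar hn) :=
  ⟨isOnePI_pic122_1, isOnePI_pic122_2 hn2, isOnePI_pic122_3 hn4, isOnePI_pic122_4 hn, isOnePI_pic122_5 hn2,
    isOnePI_pic122_6, isOnePI_pic122_7 hn⟩

/-- kernel: in particular the seven pictures of (1.22) are connected graphs in the sense of p. 415.
[cite: Balaban1983Higgs3, p.415] -/
theorem pictures122_isConnected (hn : 1 ≤ nbar) (hn2 : 2 ≤ nbar) (hn4 : 4 ≤ nbar) :
    IsConnected (g36c nbar) ∧ IsConnected (g36b nbar hn2) ∧ IsConnected (g318b nbar hn4) ∧ IsConnected (g36a nbar hn) ∧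
      IsConnected (g318a nbar hn2) ∧ IsConnected (g318g nbar) ∧ IsConnected (g122g nbar hn) := by
  obtain ⟨h1, h2, h3, h4, h5, h6, h7⟩ := pictures122_isOnePI hn hn2 hn4
  exact ⟨h1.1, h2.1, h3.1, h4.1, h5.1, h6.1, h7.1⟩

/-- kernel: the seven pictures are proper self-energy insertions (no line separates their two external legs).
[cite: Balaban1983Higgs3, (1.22) p.416] -/
theorem pictures122_isProper (hn : 1 ≤ nbar) (hn2 : 2 ≤ nbar) (hn4 : 4 ≤ nbar) :
    IsProper (g36c nbar) ∧ IsProper (g36b nbar hn2) ∧ IsProper (g318b nbar hn4) ∧ IsProper (g36a nbar hn) ∧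
      IsProper (g318a nbar hn2) ∧ IsProper (g318g nbar) ∧ IsProper (g122g nbar hn) := by
  obtain ⟨h1, h2, h3, h4, h5, h6, h7⟩ := pictures122_isOnePI hn hn2 hn4
  exact ⟨h1.isProper, h2.isProper, h3.isProper, h4.isProper, h5.isProper, h6.isProper, h7.isProper⟩

end Pictures122

end Literature.MathematicalPhysics.QuantumFieldTheory.Balaban1983to89.B3OnePIGraphs
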